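import Summits.QuantumFields.BalabanUV.T4Continuum.Support.NE7EnergyRateWPrepGeneric
import Summits.QuantumFields.BalabanUV.T4Continuum.Support.NE7EnergyRateWGeneric
import Summits.QuantumFields.BalabanUV.T4Continuum.Support.NE7PairDecompNL0Generic
import Summits.QuantumFields.BalabanUV.T4Continuum.Support.NE7EnergyClassPoincareGeneric
import HarnessLib

/-!
# NE7EnergyRateWGenericL — PORT MAP P3.5 (part 2∕2): NODE NE3's RE-TYPED ROOT T-E_w♯ AT `d = 4`, ANY BLOCK SIZE `L ≥ 2`, ANY UNITARY GAUGE GROUP `U(card n)` — gen 105's assembly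
# `NE7EnergyRateWGeneric.ne3EnergyRateWSup_of_classPoincare` (`L = 2`) RE-ISSUED under the road's recipe `2 ↦ L` (`sfClass 4 L`, `(L:ℝ)^k`, periods `N·L^k`), modulo the class
# slice-Poincaré inequality of `𝒯_E` and the class level family AT BLOCK SIZE `L` (both clauses of ✓ p807957 `NE7EnergyClassPoincareGeneric.classPackage`), and then
# UNCONDITIONALLY: **`ne3EnergyRateWSup_anyGroup_L`** — for every `L ≥ 2` and every nonempty finite `n`,
# `∃ ε₀ > 0, ∀ 0 < ε ≤ ε₀, ∀ b g, 0 ≤ b → b + 226·320²·L²·b² ≤ ε → 0 < g → ∃ C s ≥ 0, ∀ N ≥ 1, ∀ dom, NE3EnergyRateWSup 4 (sfClass 4 L N ε) L N b g C s dom`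

Cell `pub-balaban`, rung (B)+1 sub-cell t4, lineage `b2b-balaban-t4-ne7b-p1` (row NE7b OWNER + CRUX PROVER), generation 156 — INTERFACE REQUEST NE7→NE7b PORT P3.5 of the road
t4-ne7-p1 g109 ([NE7P1-G109-INBOX-2]; memo `t4/b2b-balaban-t4-ne7-p1-g109/ROAD-G109.md` §3).  Inputs: part 1 `NE7EnergyRateWPrepGeneric` (`residualScale_lower`, `cavg_admissible`,
`dualC2_pos`), gen 105's block-size-free bookkeeping (`NE7EnergyRateWGeneric.line_of_small_card`, `kfree_coercivity_card`; `NE7EnergyRateWPrep.spike_coef_le`, `spike_energy_le`,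
`two_sided_ineq`, `rate_algebra`, `ratio_le_of_lower` — read at the weight `w₀ = 2·wallConst 4 L·dualC2 4 L·√g∕L`, so that `w₀·N²∕(2M) = wallConst·dualC2·√g·N²∕(L·M)`),
the road's ✓ p809833 `NE7PairDecompNL0Generic.decomp_of_nl0_pair_generic` (threshold `10²¹·L⁶·card n·ε ≤ 1`) and ✓ p807957 `classPackage`; the analytic letters
(`curlSq_ge_weighted`, `hess_vary_ge_weighted`, `smallField_vary_segment_class`, (RES♯) `abs_dAction_le_of_regular_slice`, `spike_tangent_data`, `energyNormW_spike_sq_le`,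
`taylor_lower`, `levelAction_gaugeAct`) were always stated at a general block size.  THE COMPETITOR LINE: `cavg L U_B` is admissible when `b + 226·320²·L²·b² ≤ ε`
(`prop1Radius 4 L (b∕(L^{j+2})²) ≤ ε∕(L^{j+1})²`); at `L = 2` this is gen 105's `b + 10⁸b² ≤ ε` up to rounding (`226·320²·4 = 92 569 600`).
WHAT ([folklore]; 0 def, 0 sorry; proof = gen 105's eleven steps verbatim under the recipe).  **`ne3EnergyRateWSup_of_classPoincare_L`** (displayed: the `𝒯_E` class Poincaré
constant `CP₀` on `sfClass 4 L N ε (j+1)` for `ε ≤ ε₁`, the level family for `ε ≤ ε₁`, the cap `512·5·8·L²·ε₁ ≤ 1`); **`ne3EnergyRateWSup_anyGroup_L`** (`2 ≤ L`, any `n`; the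
three displays discharged by `classPackage`, whose radius `θ₀` carries `1024·5·8·L²·θ₀ ≤ 1`).
HONEST FRAMING (page 1): composition of landed kernel theorems of rows NE3 and NE7 and of [B7]∕[B8]∕[B11] AS TYPED; nothing of Bałaban's asserted as an axiom; `n : Type`; constants
existential; NOT NE3∕NE7 as spine nodes (the dagwriter∕referees' call); non-vacuity of regular minimiser pairs at block size `L` is the road's ✓ p810624
`all_minimisers_regular_generic`, not used here; row NE7b (`T4WeightBudget.RelWeightBound`) NOT PRINTED ∕ NOT PROVED; finite T⁴ rung (B)+1 — NOT infinite volume, NOT mass gap,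
NOT BetaPertH, NOT Clay (continuum YM on T⁴ ⇐ BetaPertH ∧ nine spine estimates).
-/

set_option autoImplicit false

open scoped BigOperators Matrix Matrix.Norms.L2Operator
open NormedSpace Finset Set

namespace Summit.QuantumFields.BalabanUV.T4Continuum.NE7EnergyRateWGenericL

open Literature.MathematicalPhysics.QuantumFieldTheory.Balaban1983to89
open B7Prop1Explicit B7Prop2Explicit
open T4AveragingDeficitWall (IsUnitaryCfg IsSkewDir SmallField fineAction vary curl curlSq dirSq)
open T4AveragingDeficitWallBoundary (IsPeriodicCfg periodBox)
open T4ConvexResponse (taylor_lower)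
open AveragingDeficitPeriodicCounting (IsPeriodicDir)
open AveragingDeficitDerivWallProof (wallConst wallConst_nonneg)
open AveragingDeficitDualResidual (dualC2 dualC1)
open AveragingDeficitChartCalculus (cavg)
open AveragingDeficitMultiLevelPrep (LevelSmall tower)
open MinimalActionLevels (perWin levelAction stepWt_pos)
open MinimalActionSandwich (IsMinimiser admissible)
open MinimalActionRate (sfClass Regular)
open NE3HessForm (dAction hess segment_derivData)
open NE3EnergyShapes (IsUnitarySite IsPeriodicSite residualScale residualScale_nonneg dualC1_nonneg dualC2_nonneg)
open NE3EnergyWeightedShapes (energyNormW energyNormW_nonneg)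
open NE3EnergyWeightedSupShape (NE3EnergyRateWSup)
open NE3ProductPathBounds (energyNormW_sub_le)
open NE3RightInverseSupLetters (frameC)
open NE3AxialGaugeLadder (smallField_gaugeAct)
open NE3SlicePoincareShape (SlicePoincare)
open NE7MeanZeroGaugeSliceW (energyBlockLandauW)
open NE7ConvOneStepWeighted (curlSq_ge_weighted hess_vary_ge_weighted)
open NE7SegmentPlaquetteRadius (smallField_vary_segment_class)
open NE7OneStepLetters (abs_dAction_le_radius_mul)
open NE7ExactCurrent (dAction_add)
open NE7EtaMinimiserGaugeCovariance (levelAction_gaugeAct)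
open NE7PairDecompNL0Generic (decomp_of_nl0_pair_generic)
open NE7EnergySliceSpikeResidual (energyNormW_spike_sq_le spike_tangent_data abs_dAction_le_of_regular_slice)
open BlockAveragePushDirGauge (gaugeDir)
open NE3CornerSpikes (spikeW)
open NE3TangentCovariantTower (framePotW)
open NE7EnergyClassPoincareGeneric (classPackage)

open NE7EnergyRateWPrep (wallConst_pos spike_coef_le spike_energy_le two_sided_ineq rate_algebra ratio_le_of_lower)
open NE7EnergyRateWGeneric (line_of_small_card kfree_coercivity_card)
open NE7EnergyRateWPrepGeneric (dualC2_pos residualScale_lower cavg_admissible)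

noncomputable section

set_option maxHeartbeats 800000 in
/-- **NODE NE3's RE-TYPED ROOT T-E_w♯ AT `d = 4`, BLOCK SIZE `L ≥ 2`, ANY `U(card n)`, MODULO THE CLASS SLICE-POINCARÉ INEQUALITY OF `𝒯_E` AND THE CLASS LEVEL FAMILY AT BLOCK
SIZE `L`** (gen 105's assembly verbatim under the recipe `2 ↦ L`; statement in the file header). [folklore] -/
theorem ne3EnergyRateWSup_of_classPoincare_L {n : Type} [Fintype n] [DecidableEq n] [Nonempty n] {L : ℕ} (hL : 2 ≤ L) {CP₀ ε₁ : ℝ} (hCP₀0 : 0 ≤ CP₀)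
    (hε₁ : 0 < ε₁) (hε₁cap : 512 * (((4 : ℕ) : ℝ) + 1) * (((4 : ℕ) : ℝ) + 4) * (L : ℝ) ^ 2 * ε₁ ≤ 1)
    (hls : ∀ {ε : ℝ}, 0 ≤ ε → ε ≤ ε₁ → ∀ k : ℕ, LevelSmall 4 L k (ε / ((L : ℝ) ^ (k + 1)) ^ 2))
    (hPclass : ∀ (N : ℕ) [NeZero N], 1 ≤ N → ∀ ε : ℝ, 0 < ε → ε ≤ ε₁ → ∀ (j : ℕ) (W : Site 4 → Fin 4 → (Matrix n n ℂ)ˣ),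
      W ∈ sfClass 4 L N ε (j + 1) →
        SlicePoincare L (j + 1) W (energyBlockLandauW (d := 4) (n := n) L N (j + 1) W) CP₀ (periodBox (d := 4) (N * L ^ (j + 1)))) :
    ∃ ε₀ : ℝ, 0 < ε₀ ∧ ∀ ε : ℝ, 0 < ε → ε ≤ ε₀ → ∀ b g : ℝ, 0 ≤ b → b + 226 * 320 ^ 2 * (L : ℝ) ^ 2 * b ^ 2 ≤ ε → 0 < g →
      ∃ C s : ℝ, 0 ≤ C ∧ 0 ≤ s ∧ ∀ (N : ℕ) [NeZero N] (dom : Set (Site 4 → Fin 4 → (Matrix n n ℂ)ˣ)),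
        NE3EnergyRateWSup 4 (sfClass 4 L N ε) L N b g C s dom := by
  have hL1 : 1 ≤ L := Nat.le_trans (by norm_num) hL
  haveI : NeZero L := ⟨by omega⟩
  have hL0 : (0 : ℝ) < L := by exact_mod_cast hL1
  have hLr1 : (1 : ℝ) ≤ L := by exact_mod_cast hL1
  obtain ⟨ε₂, hε₂, CS, hCS, νc, hνc, κc, hκc, hdec⟩ := decomp_of_nl0_pair_generic (n := n) hL
  -- the k-free coercivity budget (`line_of_small_card`), Poincaré constant `CP = CP₀ + 1`, `c = card n`
  obtain ⟨c, hc⟩ : ∃ c : ℝ, c = (Fintype.card n : ℝ) := ⟨_, rfl⟩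
  have hc1 : 1 ≤ c := by rw [hc]; exact_mod_cast Fintype.card_pos
  have hc0 : 0 < c := by linarith
  obtain ⟨CP, hCP⟩ : ∃ CP : ℝ, CP = CP₀ + 1 := ⟨_, rfl⟩
  have hCP1 : 1 ≤ CP := by rw [hCP]; linarith
  have hCP0 : 0 ≤ CP := by linarith
  obtain ⟨Q, hQ⟩ : ∃ Q : ℝ, Q = 2 * (1 + CP) := ⟨_, rfl⟩
  have hQ4 : 4 ≤ Q := by rw [hQ]; linarith
  have hQ0 : 0 < Q := by linarith
  obtain ⟨cL, hcL⟩ : ∃ cL : ℝ, cL = 2 * κc + νc ^ 2 + 2304 * (CS ^ 2 * Real.exp (2 * CS)) + 112 * (1 + 7 * CS ^ 2) + 1 := ⟨_, rfl⟩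
  have hcL0 : 0 < cL := by rw [hcL]; positivity
  obtain ⟨ε₃, hε₃⟩ : ∃ ε₃ : ℝ, ε₃ = (1 / 2) / Q / 4 / c / cL := ⟨_, rfl⟩
  have hε₃0 : 0 < ε₃ := by rw [hε₃]; positivity
  have hcard : (0 : ℝ) < 1000000000000000000000 * (L : ℝ) ^ 6 * (Fintype.card n : ℝ) := by rw [← hc]; positivity
  refine ⟨min ε₂ (min ε₁ (min (1 / (1000000000000000000000 * (L : ℝ) ^ 6 * (Fintype.card n : ℝ))) (min ε₃ 1))),
    lt_min hε₂ (lt_min hε₁ (lt_min (by positivity) (lt_min hε₃0 one_pos))), ?_⟩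
  intro ε hε hεle b g hb hbq hg
  have hεε₂ : ε ≤ ε₂ := hεle.trans (min_le_left _ _)
  have hε53 : ε ≤ ε₁ := hεle.trans ((min_le_right _ _).trans (min_le_left _ _))
  have hεθ : ε ≤ 1 / (1000000000000000000000 * (L : ℝ) ^ 6 * (Fintype.card n : ℝ)) :=
    hεle.trans ((min_le_right _ _).trans ((min_le_right _ _).trans (min_le_left _ _)))
  have hεε₃ : ε ≤ ε₃ := hεle.trans ((min_le_right _ _).trans ((min_le_right _ _).trans ((min_le_right _ _).trans (min_le_left _ _))))
  have hε1 : ε ≤ 1 := hεle.trans ((min_le_right _ _).trans ((min_le_right _ _).trans ((min_le_right _ _).trans (min_le_right _ _))))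
  have hθline : 1000000000000000000000 * (L : ℝ) ^ 6 * (Fintype.card n : ℝ) * ε ≤ 1 := by
    rw [le_div_iff₀ hcard] at hεθ; linarith
  -- the [B7] Prop. 1 cap and the level family at this `ε`
  have hcapε : 512 * (((4 : ℕ) : ℝ) + 1) * (((4 : ℕ) : ℝ) + 4) * (L : ℝ) ^ 2 * ε ≤ 1 := by
    have : 512 * (((4 : ℕ) : ℝ) + 1) * (((4 : ℕ) : ℝ) + 4) * (L : ℝ) ^ 2 * ε ≤ 512 * (((4 : ℕ) : ℝ) + 1) * (((4 : ℕ) : ℝ) + 4) * (L : ℝ) ^ 2 * ε₁ :=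
      mul_le_mul_of_nonneg_left hε53 (by positivity)
    exact this.trans hε₁cap
  have hlsε : ∀ k : ℕ, LevelSmall 4 L k (ε / ((L : ℝ) ^ (k + 1)) ^ 2) := hls hε.le hε53
  -- the strict line: `2κ_c ε < cK`, i.e. the gap `γ := cK/2 − κ_c ε > 0`
  have hsmall : cL * ε ≤ (1 / 2) / Q / 4 / c := by
    have h1 : cL * ε ≤ cL * ε₃ := mul_le_mul_of_nonneg_left hεε₃ hcL0.le
    have h2 : cL * ε₃ = (1 / 2) / Q / 4 / c := by rw [hε₃]; field_simp
    linarith only [h1, h2]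
  have hline := line_of_small_card hQ4 hc1 hCS hε hε1 (by rw [← hcL]; exact hsmall)
  obtain ⟨cK, hcK⟩ : ∃ cK : ℝ, cK = ((((1 / 2 - (νc * ε) ^ 2) / Q - (νc * ε) ^ 2) / 2 - 576 * ((4 : ℕ) : ℝ) * ((CS * ε) ^ 2 * Real.exp (2 * (CS * ε)))) / c
      - 28 * ((4 : ℕ) : ℝ) * (ε + 7 * (CS * ε) ^ 2)) := ⟨_, rfl⟩
  rw [← hcK] at hline
  obtain ⟨γ, hγ⟩ : ∃ γ : ℝ, γ = cK / 2 - κc * ε := ⟨_, rfl⟩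
  have hγ0 : 0 < γ := by rw [hγ]; linarith
  -- the constants of the bound (the (RES♯) constant of `abs_dAction_le_of_regular_slice` at `d = 4`, block size `L`)
  obtain ⟨C', hC'⟩ : ∃ C' : ℝ, C' = (Real.sqrt ((L : ℝ) ^ (4 - 2))
            + (Real.sqrt ((L : ℝ) ^ (4 - 2)) * Real.sqrt (8 * Fintype.card (T4AveragingDeficitWall.Plane 4))
                * (128 * ((4 : ℕ) * (L : ℝ) ^ 2))
              + 2 * (2048 * (((4 : ℕ) : ℝ) + 4) ^ 2 * (L : ℝ) ^ 2 * Real.sqrt ((4 : ℕ) * (L : ℝ) ^ 4))) * b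
            + b ^ 2 * (2 * (L : ℝ) ^ (4 - 1) + 2 * (8 * (4 : ℕ) * (L : ℝ) ^ 4)) * Real.sqrt ((4 : ℕ) / (g * (L : ℝ) ^ (4 + 2)))) := ⟨_, rfl⟩
  have hC'0 : 0 ≤ C' := by rw [hC']; positivity
  obtain ⟨G, hG⟩ : ∃ G : ℝ, G = frameC 4 L * (CS * ε) := ⟨_, rfl⟩
  have hG0 : 0 ≤ G := by rw [hG]; have := NE7FrameFreeRightInverse.frameC_nonneg 4 L; positivity
  obtain ⟨σ, hσ⟩ : ∃ σ : ℝ, σ = Real.sqrt (4 * (Fintype.card (T4AveragingDeficitWall.Plane 4) : ℝ) + 16) * G := ⟨_, rfl⟩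
  have hσ0 : 0 ≤ σ := by rw [hσ]; positivity
  obtain ⟨w₀, hw₀⟩ : ∃ w₀ : ℝ, w₀ = 2 * wallConst 4 L * dualC2 4 L * Real.sqrt g / (L : ℝ) := ⟨_, rfl⟩
  have hw₀0 : 0 < w₀ := by
    rw [hw₀]; exact div_pos (mul_pos (mul_pos (mul_pos two_pos (wallConst_pos 4 L)) (dualC2_pos hL1)) (Real.sqrt_pos.2 hg)) hL0
  obtain ⟨Cfin, hCfin⟩ : ∃ Cfin : ℝ, Cfin = C' * (1 + νc * ε) / γ + Real.sqrt (2 * C' * σ / (γ * w₀)) := ⟨_, rfl⟩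
  refine ⟨Cfin, CS * ε, by rw [hCfin]; positivity, by positivity, ?_⟩
  intro N _ dom k hk V _ UA UB hA hB hreg
  have hN : 1 ≤ N := Nat.one_le_iff_ne_zero.mpr (NeZero.ne N)
  obtain ⟨j, rfl⟩ : ∃ j, k = j + 1 := ⟨k - 1, by omega⟩
  have hB' : IsMinimiser 4 (sfClass 4 L N ε) L N (j + 2) V UB := hB
  have hreg' : Regular 4 L N b g (j + 2) UB := hreg
  -- the competitor `W := cavg L U_B` and its class data
  obtain ⟨hbε, hs1, hs2, hWu, hWP, hWx, hWadm⟩ := cavg_admissible (N := N) hL j hε hcapε hlsε hb hbq hB' hreg'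
  have htow : ((tower L N (j + 1) : ℕ) : ℤ) = ((N * L ^ (j + 1) : ℕ) : ℤ) := by rw [NE3EnergyRateWSupOfSlicePoincare.tower_eq_mul_pow]
  have hWPt : IsPeriodicCfg (cavg L UB) ((tower L N (j + 1) : ℕ) : ℤ) := by rw [htow]; exact hWP
  have hM0 : (0 : ℝ) < (L : ℝ) ^ (j + 1) := by positivity
  have hM1 : (1 : ℝ) ≤ (L : ℝ) ^ (j + 1) := one_le_pow₀ hLr1
  have hx : 0 ≤ ε / ((L : ℝ) ^ (j + 1)) ^ 2 := by positivity
  -- the pair decomposition in the slice gauge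
  obtain ⟨u, X, XT, XN, α, ν, κ, hu, huP, hXs, hXP, hα, hXα, hgauge, hXdec, hXT, hframe, hXN, hν, hNw, hN1, hαM, hνle, hκle⟩ :=
    hdec N ε hε hεε₂ hθline V j (cavg L UB) hWadm UA hA.mem
  have hE0 := energyNormW_nonneg L (j + 1) (cavg L UB) X (periodBox (d := 4) (N * L ^ (j + 1)))
  -- (1) the weighted Poincaré letter on the class (constant `CP₀ ≤ CP`)
  have hP0 := hPclass N hN ε hε hε53 j (cavg L UB) ⟨hWu, hWP, hWx⟩
  have hP := NE3SlicePoincareShape.slicePoincare_mono hP0 (show CP₀ ≤ CP by rw [hCP]; linarith)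
  have hNw2 : energyNormW L (j + 1) (cavg L UB) XN (periodBox (d := 4) (N * L ^ (j + 1))) ^ 2
      ≤ ν ^ 2 * energyNormW L (j + 1) (cavg L UB) X (periodBox (d := 4) (N * L ^ (j + 1))) ^ 2 := by
    have h0 := energyNormW_nonneg L (j + 1) (cavg L UB) XN (periodBox (d := 4) (N * L ^ (j + 1)))
    calc _ ≤ (ν * energyNormW L (j + 1) (cavg L UB) X (periodBox (d := 4) (N * L ^ (j + 1)))) ^ 2 := pow_le_pow_left₀ h0 hNw 2
      _ = _ := by ring
  have hm := curlSq_ge_weighted (L := L) (k := j + 1) hCP0 hP hXdec hXT hNw2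
  -- (2) the plaquette radius along the segment, (3) the convexity letter
  have h1 : SmallField (vary (cavg L UB) X 1) (ε / ((L : ℝ) ^ (j + 1)) ^ 2) := by
    rw [← hgauge]; exact smallField_gaugeAct hu hA.mem.1.2.2
  have hrad : ∀ t ∈ Icc (0 : ℝ) 1, SmallField (vary (cavg L UB) X t) (ε / ((L : ℝ) ^ (j + 1)) ^ 2 + 7 * α ^ 2) := fun t ht =>
    smallField_vary_segment_class hWu hXs hWx h1 hXα ht
  have ha' : 0 ≤ ε / ((L : ℝ) ^ (j + 1)) ^ 2 + 7 * α ^ 2 := by positivity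
  have hNM : 1 ≤ N * L ^ (j + 1) := Nat.mul_pos (by omega) (Nat.pow_pos (by omega))
  have hconv : ∀ t ∈ Icc (0 : ℝ) 1,
      ((((1 / 2 - ν ^ 2) / (2 * (1 + CP)) - ν ^ 2) / 2 - 576 * ((4 : ℕ) : ℝ) * (Real.exp α - 1) ^ 2 * ((L : ℝ) ^ (j + 1)) ^ 2)
            / (Fintype.card n : ℝ)
          - 28 * ((4 : ℕ) : ℝ) * (ε / ((L : ℝ) ^ (j + 1)) ^ 2 + 7 * α ^ 2) * ((L : ℝ) ^ (j + 1)) ^ 2)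
          * energyNormW L (j + 1) (cavg L UB) X (periodBox (d := 4) (N * L ^ (j + 1))) ^ 2
        ≤ hess (vary (cavg L UB) X t) X X (perWin 4 (N * L ^ (j + 1))) := fun t ht =>
    hess_vary_ge_weighted (d := 4) (L := L) (k := j + 1) hL1 hNM hWu hXs hXP hα hXα hm ht ha' (hrad t ht)
  -- the k-free minorant `cK ≤ c_k`
  have hck : cK ≤ ((((1 / 2 - ν ^ 2) / (2 * (1 + CP)) - ν ^ 2) / 2 - 576 * ((4 : ℕ) : ℝ) * (Real.exp α - 1) ^ 2 * ((L : ℝ) ^ (j + 1)) ^ 2)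
            / (Fintype.card n : ℝ)
          - 28 * ((4 : ℕ) : ℝ) * (ε / ((L : ℝ) ^ (j + 1)) ^ 2 + 7 * α ^ 2) * ((L : ℝ) ^ (j + 1)) ^ 2) := by
    rw [← hc, hcK, hQ]
    exact kfree_coercivity_card hc0 hCP0 hM1 hν hνle hα hαM
  -- (4) Taylor along the segment and (5) minimality of `U_A` against the admissible `W`
  obtain ⟨hd1, hd2⟩ := segment_derivData (cavg L UB) X (perWin 4 (N * L ^ (j + 1)))
  have htaylor := taylor_lower hd1 hd2 (fun t ht => (mul_le_mul_of_nonneg_right hck (sq_nonneg _)).trans (hconv t ht))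
  rw [T4AveragingDeficitWall.vary_zero] at htaylor
  have hmin : fineAction (vary (cavg L UB) X 1) (perWin 4 (N * L ^ (j + 1))) ≤ fineAction (cavg L UB) (perWin 4 (N * L ^ (j + 1))) := by
    have hle := hA.le (cavg L UB) hWadm
    rw [← levelAction_gaugeAct L N (j + 1) u UA, hgauge] at hle
    unfold levelAction at hle
    have hw : 0 < ((MinimalActionLevels.stepWt 4 L)⁻¹) ^ (j + 1) := pow_pos (inv_pos.mpr (stepWt_pos (d := 4) L hL1)) _
    exact le_of_mul_le_mul_left hle hw
  -- (6) the split of the first variation: the normal part's curl letter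
  have hsplit : dAction (cavg L UB) X (perWin 4 (N * L ^ (j + 1)))
      = dAction (cavg L UB) XT (perWin 4 (N * L ^ (j + 1))) + dAction (cavg L UB) XN (perWin 4 (N * L ^ (j + 1))) := by
    conv_lhs => rw [hXdec]
    exact dAction_add _ _ _ _
  have hNpart : |dAction (cavg L UB) XN (perWin 4 (N * L ^ (j + 1)))| ≤ κ * energyNormW L (j + 1) (cavg L UB) X (periodBox (d := 4) (N * L ^ (j + 1))) ^ 2 :=
    (abs_dAction_le_radius_mul hWu hXN hWx (perWin 4 (N * L ^ (j + 1)))).trans hN1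
  -- (7)–(8) (RES♯) on the slice part, with the spike's weighted energy
  have hres := abs_dAction_le_of_regular_slice (n := n) (d := 4) (by norm_num) hL1 hN j hb hbε hg hs2 hB' hreg'
    hWu hWPt hx hs1 hWx hXT
  obtain ⟨-, -, -, hfP, -⟩ := spike_tangent_data (N := N) hL1 j hWu hWPt hx hs1 hWx hXT
  have hS2 := energyNormW_spike_sq_le (d := 4) hL1 hN j hWu hWx hfP hframe
  have hES0 := energyNormW_nonneg L (j + 1) (cavg L UB) (gaugeDir (cavg L UB) (spikeW (L ^ (j + 1)) (framePotW L (j + 1) (cavg L UB) XT)))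
      (periodBox (d := 4) (N * L ^ (j + 1)))
  have hET := energyNormW_sub_le L (j + 1) (cavg L UB) X XN (periodBox (d := 4) (N * L ^ (j + 1)))
  have hXTeq : XT = X - XN := eq_sub_of_add_eq hXdec.symm
  rw [← hXTeq] at hET
  have hρlow := residualScale_lower hL1 N j (b := b) hg.le
  have hρ0 := residualScale_nonneg 4 L N b g (j + 1)
  -- ABSTRACT THE ATOMS and do the arithmetic with gen 105's pure real lemmas
  set M : ℝ := (L : ℝ) ^ (j + 1) with hM
  set E : ℝ := energyNormW L (j + 1) (cavg L UB) X (periodBox (d := 4) (N * L ^ (j + 1))) with hE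
  set ET : ℝ := energyNormW L (j + 1) (cavg L UB) XT (periodBox (d := 4) (N * L ^ (j + 1))) with hETdef
  set EN : ℝ := energyNormW L (j + 1) (cavg L UB) XN (periodBox (d := 4) (N * L ^ (j + 1))) with hENdef
  set ES : ℝ := energyNormW L (j + 1) (cavg L UB) (gaugeDir (cavg L UB) (spikeW (L ^ (j + 1)) (framePotW L (j + 1) (cavg L UB) XT)))
      (periodBox (d := 4) (N * L ^ (j + 1))) with hESdef
  set ρ : ℝ := residualScale 4 L N b g (j + 1) with hρ
  set P : ℝ := (Fintype.card (T4AveragingDeficitWall.Plane 4) : ℝ) with hPdef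
  have hP0' : 0 ≤ P := by rw [hPdef]; positivity
  -- `hres` in the abstract currency: `|dAction W X_T| ≤ C'ρ (ET + ES)`
  have hres' : |dAction (cavg L UB) XT (perWin 4 (N * L ^ (j + 1)))| ≤ C' * ρ * (ET + ES) := by rw [hC']; exact hres
  have hr0 : 0 ≤ C' * ρ := mul_nonneg hC'0 hρ0
  -- the spike's weighted energy: `ES ≤ σ·N²/M`
  have hESle : ES ≤ σ * ((N : ℝ) ^ 2 / M) := by
    have h := spike_energy_le hES0 hG0 hM0 hP0' (by rw [hG]; exact hS2)
      (spike_coef_le hM1 hε.le hε1 hP0')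
    rw [hσ, hPdef]; simpa only [mul_assoc] using h
  -- (9) the two-sided inequality `γ E² ≤ C'ρ(1+ν_c ε)·E + C'ρ·σ·N²/M`
  have hkey : dAction (cavg L UB) X (perWin 4 (N * L ^ (j + 1))) + cK * E ^ 2 / 2 ≤ 0 := by linarith only [htaylor, hmin]
  have hETle : ET ≤ (1 + νc * ε) * E := by
    have : EN ≤ νc * ε * E := hNw.trans (mul_le_mul_of_nonneg_right hνle hE0)
    linarith only [hET, this]
  have hTpart : |dAction (cavg L UB) XT (perWin 4 (N * L ^ (j + 1)))| ≤ C' * ρ * ((1 + νc * ε) * E + σ * ((N : ℝ) ^ 2 / M)) :=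
    hres'.trans (mul_le_mul_of_nonneg_left (by linarith only [hETle, hESle]) hr0)
  have hγE : γ * E ^ 2 ≤ C' * ρ * (1 + νc * ε) * E + C' * ρ * (σ * ((N : ℝ) ^ 2 / M)) := by
    rw [hγ]; exact two_sided_ineq hkey hsplit hNpart hTpart hκle
  -- (10) `N²/M ≤ 2ρ/w₀` (the weight `w₀ = 2·wallConst·dualC2·√g/L` turns `w₀N²/(2M)` into `wallConst·dualC2·√g·N²/(L·M)`) and the final bookkeeping
  have hρlow' : w₀ * (N : ℝ) ^ 2 / (2 * M) ≤ ρ := by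
    have e : w₀ * (N : ℝ) ^ 2 / (2 * M) = wallConst 4 L * dualC2 4 L * Real.sqrt g * (N : ℝ) ^ 2 / ((L : ℝ) * M) := by
      rw [hw₀]; field_simp
    rw [e]; exact hρlow
  have hNM' : (N : ℝ) ^ 2 / M ≤ 2 * ρ / w₀ := ratio_le_of_lower hM0 hw₀0 hρlow'
  have hfinal : E ≤ Cfin * ρ := by
    rw [hCfin]
    exact rate_algebra hρ0 hγ0 hC'0 (by positivity) hσ0 hw₀0 (by positivity) hNM' hγE
  -- (11) the sup letter: `‖X(b)‖ ≤ α ≤ C_S ε / M = (C_S ε)·L^{−(j+1)}`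
  have hsup : ∀ (x : Site 4) (κ' : Fin 4), ‖X x κ'‖ ≤ CS * ε * (((L : ℝ))⁻¹) ^ (j + 1) := by
    intro x κ'
    have hαle : α ≤ CS * ε / M := by rw [le_div_iff₀ hM0]; exact hαM
    have e : CS * ε * (((L : ℝ))⁻¹) ^ (j + 1) = CS * ε / M := by rw [inv_pow, hM]; ring
    rw [e]; exact (hXα x κ').trans hαle
  exact ⟨u, X, hu, huP, hXs, hXP, hgauge, hfinal, hsup⟩

/-- **T-E_w♯ AT `d = 4` FOR EVERY BLOCK SIZE `L ≥ 2` AND EVERY UNITARY GAUGE GROUP `U(n)`, NO DISPLAYED HYPOTHESIS** (the road's requested conclusion of PORT P3.5): the three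
displays of `ne3EnergyRateWSup_of_classPoincare_L` are discharged by ✓ p807957 `classPackage` at `d = 4` (its radius `θ₀` carries the level family, the `𝒯_E` class Poincaré
constant `C_E`, and `1024·5·8·L²·θ₀ ≤ 1`, hence the [B7] cap). [folklore] -/
theorem ne3EnergyRateWSup_anyGroup_L {n : Type} [Fintype n] [DecidableEq n] [Nonempty n] {L : ℕ} (hL : 2 ≤ L) :
    ∃ ε₀ : ℝ, 0 < ε₀ ∧ ∀ ε : ℝ, 0 < ε → ε ≤ ε₀ → ∀ b g : ℝ, 0 ≤ b → b + 226 * 320 ^ 2 * (L : ℝ) ^ 2 * b ^ 2 ≤ ε → 0 < g →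
      ∃ C s : ℝ, 0 ≤ C ∧ 0 ≤ s ∧ ∀ (N : ℕ) [NeZero N] (dom : Set (Site 4 → Fin 4 → (Matrix n n ℂ)ˣ)),
        NE3EnergyRateWSup 4 (sfClass 4 L N ε) L N b g C s dom := by
  obtain ⟨θ₀, CF, CE, hθ₀, -, -, hCE, -, hcap, hls, -, hPE⟩ := classPackage (n := n) (d := 4) (by norm_num) hL
  have hcap' : 512 * (((4 : ℕ) : ℝ) + 1) * (((4 : ℕ) : ℝ) + 4) * (L : ℝ) ^ 2 * θ₀ ≤ 1 := by
    push_cast at hcap ⊢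
    nlinarith [hθ₀, sq_nonneg (L : ℝ)]
  exact ne3EnergyRateWSup_of_classPoincare_L (n := n) hL hCE hθ₀ hcap' (fun hε hεθ k => hls hε hεθ k)
    (fun N _ hN ε hε hεθ j W hW => hPE hN hε hεθ j W hW)

end

end Summit.QuantumFields.BalabanUV.T4Continuum.NE7EnergyRateWGenericL
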